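import Literature.NumberTheory.LFunctions.WeilExplicitContinuous
import Summits.RiemannHypothesis.RiemannHypothesis.Theorems.SpectralTraceWindowTraceArchStubCompactness
import Summits.RiemannHypothesis.RiemannHypothesis.Theorems.SpectralTraceWindowTraceArchStubDomination
import Summits.RiemannHypothesis.RiemannHypothesis.Theorems.SpectralTraceWindowTraceArchStubDenseFamily
import Summits.RiemannHypothesis.RiemannHypothesis.Theorems.SpectralTraceWindowTraceArchStubExtensionOfDense
import HarnessLib

/-!
# Designs at level `B` give the rung `Trace(B)` (`stub_designReduction`)

Stub `stub_designReduction` of the line `split-birth` for the crux `WindowStep`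
(stmt-RiemannHypothesis-14659, route `SpectralTrace`; skeleton
`Summit.RiemannHypothesis.RiemannHypothesis.Cruxes.WindowStep.Lines.split_birth`).

**Statement.** Let `B ≥ log 2`. Suppose there are a configuration `x : ℕ → ℝ` with a polynomial
local count profile (`#{n : |x n - T| ≤ 1} ≤ C (1 + |T|)^N`) and ONE displacement budget `D` such
that every finite list `g₀, …, g_{m-1}` of Weil tests supported in `[-B, B]` is reproduced exactly
by some displacement `|δ n| ≤ D`: `HasSum_n ĝⱼ(1/2 + i(x n + δ n)) = W(gⱼ)` for `j < m`. Then the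
rung `Trace(B)` holds: some real family `γ` has `HasSum_i ĝ(1/2 + iγ_i) = W(g)` for every Weil
test `g` supported in `[-B, B]`.

**Proof.** The level-`B` copy of the chain landed at level `log 2` for the seed crux
`WindowTraceArch` (`stub_designIffCrux`, direction `→`):
1. `stub_denseFamily_of_isCompact` (level-free) gives a countable family `g j` of Weil tests of
   `[-B, B]`, dense in every `C^k` sup-seminorm among the Weil tests of `[-B, B]`;
2. the hypothesis gives, for each `m`, a displacement `δ m` exact on the prefix `g 0, …, g (m-1)`,
   so `∀ j, ∀ᶠ m, HasSum … (δ m)`;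
3. `stub_compactness` fed by `stub_domination` (both landed, level-free) gives ONE displacement
   `δ'`, `|δ' n| ≤ D`, exact on the whole dense family;
4. `stub_designReduction_extension` (this file: the level-`B` analogue of the landed
   `stub_extensionOfDense`) extends exactness to every Weil test of `[-B, B]` by continuity of both
   sides in the `C^3 ∨ C^k` sup-seminorms. The one new ingredient at level `B` is the prime term
   `Σₙ Λ(n) n^{-1/2} (h(log n) + h(-log n))`, which no longer vanishes but is a FINITE sum of point
   values (`n < ⌈e^{B+1}⌉`, `WeilContinuous.weilPrimeTerm_eq_sum_of_support`), hence
   `‖·‖ ≤ (2 Σ_{n < ⌈e^{B+1}⌉} Λ(n)/√n) · sup ‖h‖` (`stub_designReduction_norm_weilPrimeTerm_le`).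

**Sources.** Standard distribution-theory continuity argument (L. Schwartz, *Théorie des
distributions* (1966), Ch. III §1–§3) with the elementary estimates of the terms of the Weil
explicit formula (H. Iwaniec, E. Kowalski, *Analytic Number Theory* (2004), Thm 5.12,
(5.44)–(5.45)). All ingredients are proved tree / Mathlib facts. [folklore]
-/

-- D-0017: `Summit.<S>.<S>.…` is the designed namespace of a single-problem summit; the lakefile turns
-- this linter off for `Summits`, repeated here so that standalone elaboration is warning-free too.
set_option linter.dupNamespace false

noncomputable section

open Complex Filter Set MeasureTheory
open scoped Real Topology BigOperators

namespace Summit.RiemannHypothesis.RiemannHypothesis.Theorems.SpectralTraceWindowStep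

open Literature.NumberTheory.LFunctions
open Summit.RiemannHypothesis.RiemannHypothesis.Theorems.SpectralTraceWindowTraceArch

/-! ## Integrals and point sums of functions supported in `[-B, B]` -/

/-- For `h` supported in `[-B, B]` (`0 ≤ B`) with `sup ‖h^{(i)}‖ ≤ ε`:
`∫ ‖h^{(i)}‖ ≤ ε · 2B` (the derivative vanishes off the window). [folklore] -/
theorem stub_designReduction_integral_iteratedDeriv_le {B : ℝ} (hB : 0 ≤ B) {h : ℝ → ℂ}
    (hhK : tsupport h ⊆ Set.Icc (-B) B) {i : ℕ} {ε : ℝ}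
    (hε : ∀ t, ‖iteratedDeriv i h t‖ ≤ ε) :
    ∫ t, ‖iteratedDeriv i h t‖ ≤ ε * (2 * B) := by
  have hBB : -B ≤ B := by linarith
  have h := stub_extensionOfDense_integral_le hBB (fun t => norm_nonneg (iteratedDeriv i h t))
    (fun t _ => hε t)
    (fun t ht => by rw [stub_denseFamily_iteratedDeriv_eq_zero hhK i ht, norm_zero])
  have e : B - -B = 2 * B := by ring
  rwa [e] at h

/-- **The prime term on `[-B, B]` is a finite sum of point values.** For `h` with
`tsupport h ⊆ [-B, B]` and `sup ‖h‖ ≤ ε`, only the `n < ⌈e^{B+1}⌉` contribute to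
`Σₙ Λ(n) n^{-1/2} (h(log n) + h(-log n))`, whence
`‖weilPrimeTerm h‖ ≤ (2 Σ_{n < ⌈e^{B+1}⌉} ‖Λ(n)/√n‖) ε`. [folklore] -/
theorem stub_designReduction_norm_weilPrimeTerm_le {B : ℝ} {h : ℝ → ℂ}
    (hhK : tsupport h ⊆ Set.Icc (-B) B) {ε : ℝ} (hε : ∀ t, ‖h t‖ ≤ ε) :
    ‖weilPrimeTerm h‖ ≤
      (2 * ∑ n ∈ Finset.range ⌈Real.exp (B + 1)⌉₊,
        ‖((ArithmeticFunction.vonMangoldt n : ℝ) : ℂ) / (Real.sqrt n : ℂ)‖) * ε := by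
  have h0 : ∀ u : ℝ, B < |u| → h u = 0 := fun u hu =>
    image_eq_zero_of_notMem_tsupport fun hus => by
      have hu' : |u| ≤ B := abs_le.2 ⟨(hhK hus).1, (hhK hus).2⟩
      linarith
  rw [WeilContinuous.weilPrimeTerm_eq_sum_of_support h0]
  refine (norm_sum_le _ _).trans ?_
  rw [Finset.mul_sum, Finset.sum_mul]
  refine Finset.sum_le_sum fun n _ => ?_
  rw [norm_mul]
  calc ‖((ArithmeticFunction.vonMangoldt n : ℝ) : ℂ) / (Real.sqrt n : ℂ)‖ *
        ‖h (Real.log n) + h (-Real.log n)‖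
      ≤ ‖((ArithmeticFunction.vonMangoldt n : ℝ) : ℂ) / (Real.sqrt n : ℂ)‖ * (ε + ε) :=
        mul_le_mul_of_nonneg_left ((norm_add_le _ _).trans (add_le_add (hε _) (hε _)))
          (norm_nonneg _)
    _ = 2 * ‖((ArithmeticFunction.vonMangoldt n : ℝ) : ℂ) / (Real.sqrt n : ℂ)‖ * ε := by ring

/-! ## The Weil side is small on small tests of `[-B, B]` -/

/-- **Continuity of the Weil functional on `𝒟_{[-B, B]}`, quantitatively.** For `0 ≤ B` there is
`c ≥ 0` such that every Weil test `h` supported in `[-B, B]` with `sup ‖h^{(i)}‖ ≤ ε` for `i ≤ 3`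
has `‖W(h)‖ ≤ c ε`: `‖ĥ(0)‖, ‖ĥ(1)‖ ≤ ∫ ‖h‖ e^{|t|/2} ≤ ε e^{B/2} 2B`, the prime term is a finite
sum of point values (`stub_designReduction_norm_weilPrimeTerm_le`), the archimedean integral is
`O(∫ ‖h‖ + ∫ ‖h'''‖) = O(ε · 2B)` (`stub_extensionOfDense_norm_weilArchIntegral_le`), and
`‖h(0)‖ log π ≤ ε log π`. [folklore] -/
theorem stub_designReduction_weil_bound {B : ℝ} (hB : 0 ≤ B) :
    ∃ c : ℝ, 0 ≤ c ∧ ∀ h : ℝ → ℂ, IsWeilTest h →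
      tsupport h ⊆ Set.Icc (-B) B →
      ∀ ε : ℝ, 0 ≤ ε → (∀ i ≤ 3, ∀ t : ℝ, ‖iteratedDeriv i h t‖ ≤ ε) →
        ‖weilFunctional h‖ ≤ c * ε := by
  obtain ⟨Cψ, hCψ⟩ :=
    Literature.Analysis.SpecialFunctions.Complex.exists_norm_digamma_vertical_le
      (a := 1 / 4) (by norm_num)
  set V : ℝ := 2 * B with hV
  have hV0 : 0 ≤ V := mul_nonneg zero_le_two hB
  set E : ℝ := Real.exp (B / 2) with hE
  have hE0 : 0 ≤ E := Real.exp_nonneg _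
  set A : ℝ := 8 * (|Cψ| + 1) * π with hA
  have hA0 : 0 ≤ A := by positivity
  set P : ℝ := 2 * ∑ n ∈ Finset.range ⌈Real.exp (B + 1)⌉₊,
    ‖((ArithmeticFunction.vonMangoldt n : ℝ) : ℂ) / (Real.sqrt n : ℂ)‖ with hP
  have hP0 : 0 ≤ P := mul_nonneg zero_le_two (Finset.sum_nonneg fun _ _ => norm_nonneg _)
  refine ⟨E * V + E * V + P + ‖(1 / (2 * π) : ℂ)‖ * (A * (V + V)) + ‖(Real.log π : ℂ)‖,
    by positivity, ?_⟩
  intro h hh hhK ε hε hder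
  have hBB : -B ≤ B := by linarith
  -- the sup norm of `h` itself
  have hsup : ∀ t : ℝ, ‖h t‖ ≤ ε := fun t => by
    simpa only [iteratedDeriv_zero] using hder 0 (Nat.zero_le _) t
  -- the two `L¹` norms entering the archimedean bound
  have hI0 : ∫ t, ‖h t‖ ≤ ε * V := by
    have := stub_designReduction_integral_iteratedDeriv_le hB hhK (i := 0)
      (fun t => hder 0 (Nat.zero_le _) t)
    simpa only [iteratedDeriv_zero] using this
  have hI3 : ∫ t, ‖iteratedDeriv 3 h t‖ ≤ ε * V :=
    stub_designReduction_integral_iteratedDeriv_le hB hhK (fun t => hder 3 le_rfl t)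
  -- the weighted `L¹` norm controlling `ĥ(0)` and `ĥ(1)`
  have hL1 : weilL1 h ≤ ε * E * V := by
    unfold weilL1
    have e : B - -B = V := by rw [hV]; ring
    rw [← e]
    refine stub_extensionOfDense_integral_le hBB (fun t => by positivity) (fun t ht => ?_)
      (fun t ht => ?_)
    · have h2 : Real.exp (|t| / 2) ≤ E := by
        have ht' : |t| ≤ B := abs_le.2 ⟨ht.1, ht.2⟩
        rw [hE]
        exact Real.exp_le_exp.2 (by linarith)
      exact mul_le_mul (hsup t) h2 (by positivity) hε
    · have h0 : h t = 0 := image_eq_zero_of_notMem_tsupport (fun h' => ht (hhK h'))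
      simp [h0]
  have hM0 : ‖weilMellin h 0‖ ≤ ε * E * V :=
    (norm_weilMellin_le_weilL1 hh.1.continuous hh.2 (by simp) (by simp)).trans hL1
  have hM1 : ‖weilMellin h 1‖ ≤ ε * E * V :=
    (norm_weilMellin_le_weilL1 hh.1.continuous hh.2 (by simp) (by simp)).trans hL1
  -- the archimedean integral
  have hArch : ‖weilArchIntegral h‖ ≤ A * (ε * V + ε * V) := by
    refine (stub_extensionOfDense_norm_weilArchIntegral_le hCψ hh).trans ?_
    rw [hA]
    gcongr
  -- the prime term: a finite sum of point values
  have hPr : ‖weilPrimeTerm h‖ ≤ P * ε := stub_designReduction_norm_weilPrimeTerm_le hhK hsup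
  -- the point value
  have hh0 : ‖h 0‖ ≤ ε := hsup 0
  -- assemble
  unfold weilFunctional weilPolarTerm weilArchTerm
  calc ‖weilMellin h 0 + weilMellin h 1 - weilPrimeTerm h +
          ((1 / (2 * π) : ℂ) * weilArchIntegral h - h 0 * (Real.log π : ℂ))‖
      ≤ ‖weilMellin h 0‖ + ‖weilMellin h 1‖ + ‖weilPrimeTerm h‖ +
          (‖(1 / (2 * π) : ℂ)‖ * ‖weilArchIntegral h‖ + ‖h 0‖ * ‖(Real.log π : ℂ)‖) := by
        refine (norm_add_le _ _).trans (add_le_add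
          ((norm_sub_le _ _).trans (add_le_add (norm_add_le _ _) le_rfl)) ?_)
        refine (norm_sub_le _ _).trans (add_le_add ?_ ?_) <;> rw [norm_mul]
    _ ≤ ε * E * V + ε * E * V + P * ε +
          (‖(1 / (2 * π) : ℂ)‖ * (A * (ε * V + ε * V)) + ε * ‖(Real.log π : ℂ)‖) := by
        gcongr
    _ = (E * V + E * V + P + ‖(1 / (2 * π) : ℂ)‖ * (A * (V + V)) + ‖(Real.log π : ℂ)‖) * ε := by
        ring

/-! ## Exactness on a dense family of tests of `[-B, B]` extends to all tests of `[-B, B]` -/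

/-- **Level-`B` extension of exactness from a dense family, given domination.** Let `0 ≤ B` and let
`gⱼ` be a family of Weil tests supported in `K = [-B, B]`, dense in every `C^k` sup-seminorm among
the Weil tests supported in `K`; let `x` be a poly-profile configuration, `|δ n| ≤ D`, and suppose
`n ↦ x n + δ n` reproduces `W(gⱼ)` for every `j`. Then, given the domination lemma (the statement
of `stub_domination`), it reproduces `W(f)` for every Weil test `f` supported in `K`. Proof: with
`h = f - gⱼ`, the spectral side satisfies `‖Σₙ ĥ(1/2 + i(xₙ + δₙ))‖ ≤ |K| (∫‖h‖ + ∫‖h^{(k)}‖)`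
(domination) and the Weil side `‖W(h)‖ ≤ c · sup_{i ≤ 3} ‖h^{(i)}‖_∞`
(`stub_designReduction_weil_bound`); both are `O(ε)` for `gⱼ` `ε`-close to `f` in `C^{max k 3}`,
and they agree on `gⱼ`; so `Σₙ f̂(1/2 + i(xₙ + δₙ)) = W(f)`, a `HasSum` by absolute convergence.
(Level-`B` copy of the landed `stub_extensionOfDense`.) [folklore] -/
theorem stub_designReduction_extension {B : ℝ} (hB : 0 ≤ B) :
    (∀ (x : ℕ → ℝ) (C D : ℝ) (N : ℕ),
      (∀ (T : ℝ) (s : Finset ℕ), (∀ n ∈ s, |x n - T| ≤ 1) → (s.card : ℝ) ≤ C * (1 + |T|) ^ N) →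
      ∃ (K : ℝ) (k : ℕ), ∀ f : ℝ → ℂ, Literature.NumberTheory.LFunctions.IsWeilTest f →
        ∃ b : ℕ → ℝ, Summable b ∧
          (∀ (n : ℕ) (v : ℝ), |v| ≤ D →
            ‖Literature.NumberTheory.LFunctions.weilMellin f (1 / 2 + ((x n + v : ℝ) : ℂ) * Complex.I)‖ ≤ b n) ∧
          ∑' n, b n ≤ K * ((∫ t, ‖f t‖) + ∫ t, ‖iteratedDeriv k f t‖)) →
    ∀ g : ℕ → ℝ → ℂ,
      ((∀ j, Literature.NumberTheory.LFunctions.IsWeilTest (g j) ∧ tsupport (g j) ⊆ Set.Icc (-B) B) ∧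
        ∀ f : ℝ → ℂ, Literature.NumberTheory.LFunctions.IsWeilTest f → tsupport f ⊆ Set.Icc (-B) B →
          ∀ (k : ℕ) (ε : ℝ), 0 < ε → ∃ j, ∀ i ≤ k, ∀ t : ℝ, ‖iteratedDeriv i (f - g j) t‖ ≤ ε) →
      ∀ (x : ℕ → ℝ) (C D : ℝ) (N : ℕ) (δ : ℕ → ℝ),
        (∀ (T : ℝ) (s : Finset ℕ), (∀ n ∈ s, |x n - T| ≤ 1) → (s.card : ℝ) ≤ C * (1 + |T|) ^ N) →
        (∀ n, |δ n| ≤ D) →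
        (∀ j, HasSum (fun n => Literature.NumberTheory.LFunctions.weilMellin (g j) (1 / 2 + ((x n + δ n : ℝ) : ℂ) * Complex.I))
          (Literature.NumberTheory.LFunctions.weilFunctional (g j))) →
        ∀ f : ℝ → ℂ, Literature.NumberTheory.LFunctions.IsWeilTest f → tsupport f ⊆ Set.Icc (-B) B →
          HasSum (fun n => Literature.NumberTheory.LFunctions.weilMellin f (1 / 2 + ((x n + δ n : ℝ) : ℂ) * Complex.I))
            (Literature.NumberTheory.LFunctions.weilFunctional f) := by
  intro hdom g hg x C D N δ hP hδ hex f hf hfK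
  obtain ⟨K₀, k₀, hK⟩ := hdom x C D N hP
  obtain ⟨c, hc0, hc⟩ := stub_designReduction_weil_bound hB
  -- spectral side: absolute convergence and the domination bound, for every Weil test
  have hspec : ∀ h : ℝ → ℂ, IsWeilTest h →
      Summable (fun n => weilMellin h (1 / 2 + ((x n + δ n : ℝ) : ℂ) * I)) ∧
      ‖∑' n, weilMellin h (1 / 2 + ((x n + δ n : ℝ) : ℂ) * I)‖ ≤
        |K₀| * ((∫ t, ‖h t‖) + ∫ t, ‖iteratedDeriv k₀ h t‖) := by
    intro h hh
    obtain ⟨b, hb, hbd, hbK⟩ := hK h hh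
    have hpt : ∀ n, ‖weilMellin h (1 / 2 + ((x n + δ n : ℝ) : ℂ) * I)‖ ≤ b n := fun n =>
      hbd n (δ n) (hδ n)
    refine ⟨Summable.of_norm_bounded hb hpt,
      (tsum_of_norm_bounded hb.hasSum hpt).trans (hbK.trans ?_)⟩
    have hS : 0 ≤ (∫ t, ‖h t‖) + ∫ t, ‖iteratedDeriv k₀ h t‖ :=
      add_nonneg (integral_nonneg fun _ => norm_nonneg _) (integral_nonneg fun _ => norm_nonneg _)
    exact mul_le_mul_of_nonneg_right (le_abs_self K₀) hS
  -- it suffices to identify the sum of the (absolutely convergent) series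
  obtain ⟨hfsum, -⟩ := hspec f hf
  suffices heq : ∑' n, weilMellin f (1 / 2 + ((x n + δ n : ℝ) : ℂ) * I) = weilFunctional f by
    rw [← heq]
    exact hfsum.hasSum
  set V : ℝ := 2 * B with hV
  have hV0 : 0 ≤ V := mul_nonneg zero_le_two hB
  set A : ℝ := |K₀| * (V + V) + c with hA
  have hA0 : 0 ≤ A := by positivity
  -- approximation through the dense family
  have key : ∀ ε : ℝ, 0 < ε →
      ‖∑' n, weilMellin f (1 / 2 + ((x n + δ n : ℝ) : ℂ) * I) - weilFunctional f‖ ≤ A * ε := by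
    intro ε hε
    obtain ⟨j, hj⟩ := hg.2 f hf hfK (max k₀ 3) ε hε
    obtain ⟨hgj, hgjK⟩ := hg.1 j
    set h : ℝ → ℂ := f - g j with hh_def
    have hh : IsWeilTest h := ⟨hf.1.sub hgj.1, hf.2.sub hgj.2⟩
    have hhK : tsupport h ⊆ Set.Icc (-B) B :=
      (tsupport_sub f (g j)).trans (union_subset hfK hgjK)
    -- linearity of both sides
    have hMf : ∀ s, weilMellin f s = weilMellin h s + weilMellin (g j) s := fun s => by
      rw [← weilMellin_add hh.1.continuous hh.2 hgj.1.continuous hgj.2, hh_def, sub_add_cancel]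
    have hWf : weilFunctional f = weilFunctional h + weilFunctional (g j) := by
      rw [← weilFunctional_add hh hgj, hh_def, sub_add_cancel]
    obtain ⟨hhsum, hhbound⟩ := hspec h hh
    have hsumf : HasSum (fun n => weilMellin f (1 / 2 + ((x n + δ n : ℝ) : ℂ) * I))
        (∑' n, weilMellin h (1 / 2 + ((x n + δ n : ℝ) : ℂ) * I) + weilFunctional (g j)) := by
      have := hhsum.hasSum.add (hex j)
      simpa only [← hMf] using this
    have hdiff : ∑' n, weilMellin f (1 / 2 + ((x n + δ n : ℝ) : ℂ) * I) - weilFunctional f =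
        ∑' n, weilMellin h (1 / 2 + ((x n + δ n : ℝ) : ℂ) * I) - weilFunctional h := by
      rw [hsumf.tsum_eq, hWf]
      ring
    rw [hdiff]
    -- smallness of `h`
    have hI0 : ∫ t, ‖h t‖ ≤ ε * V := by
      have := stub_designReduction_integral_iteratedDeriv_le hB hhK (i := 0)
        (fun t => hj 0 (Nat.zero_le _) t)
      simpa only [iteratedDeriv_zero] using this
    have hIk : ∫ t, ‖iteratedDeriv k₀ h t‖ ≤ ε * V :=
      stub_designReduction_integral_iteratedDeriv_le hB hhK
        (fun t => hj k₀ (le_max_left _ _) t)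
    have hW : ‖weilFunctional h‖ ≤ c * ε :=
      hc h hh hhK ε hε.le (fun i hi t => hj i (hi.trans (le_max_right _ _)) t)
    calc ‖∑' n, weilMellin h (1 / 2 + ((x n + δ n : ℝ) : ℂ) * I) - weilFunctional h‖
        ≤ ‖∑' n, weilMellin h (1 / 2 + ((x n + δ n : ℝ) : ℂ) * I)‖ + ‖weilFunctional h‖ :=
          norm_sub_le _ _
      _ ≤ |K₀| * (ε * V + ε * V) + c * ε := add_le_add (hhbound.trans (by gcongr)) hW
      _ = A * ε := by rw [hA]; ring
  -- conclusion: the two sides are arbitrarily close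
  refine eq_of_forall_dist_le fun η hη => ?_
  rw [dist_eq_norm]
  have hAη : A * (η / (A + 1)) ≤ η := by
    rw [mul_div_assoc', div_le_iff₀ (by positivity)]
    nlinarith
  exact (key (η / (A + 1)) (by positivity)).trans hAη

/-! ## The stub -/

/-- **stub_designReduction (RH-free) — designs at level `B ≥ log 2` give the rung `Trace(B)`.**
From a log-sparse configuration `x` (polynomial local count profile), a budget `D` and, for every
finite list of Weil tests of `[-B, B]`, an exact displacement within the budget: enumerate a
countable `C^k`-dense family of Weil tests of `[-B, B]` (`stub_denseFamily_of_isCompact`), pass to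
a pointwise limit displacement exact on the whole dense family (`stub_compactness`, fed by
`stub_domination`), and extend to every Weil test of `[-B, B]` by continuity of both sides
(`stub_designReduction_extension`; the Weil side carries the finite prime sum over `n < e^{B+1}`).
The family is `γ n = x n + δ' n`, indexed by `ℕ`. [folklore] -/
theorem stub_designReduction :
    ∀ B : ℝ, Real.log 2 ≤ B →
      (∃ (x : ℕ → ℝ) (C : ℝ) (N : ℕ),
        (∀ (T : ℝ) (s : Finset ℕ), (∀ n ∈ s, |x n - T| ≤ 1) → (s.card : ℝ) ≤ C * (1 + |T|) ^ N) ∧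
        ∃ D : ℝ, ∀ (g : ℕ → ℝ → ℂ) (m : ℕ),
          (∀ j, Literature.NumberTheory.LFunctions.IsWeilTest (g j) ∧ tsupport (g j) ⊆ Set.Icc (-B) B) →
          ∃ δ : ℕ → ℝ, (∀ n, |δ n| ≤ D) ∧
            ∀ j < m, HasSum
              (fun n => Literature.NumberTheory.LFunctions.weilMellin (g j) (1 / 2 + ((x n + δ n : ℝ) : ℂ) * Complex.I))
              (Literature.NumberTheory.LFunctions.weilFunctional (g j))) →
      ∃ (ι : Type) (γ : ι → ℝ), ∀ g : ℝ → ℂ, Literature.NumberTheory.LFunctions.IsWeilTest g →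
        tsupport g ⊆ Set.Icc (-B) B →
          HasSum (fun i => Literature.NumberTheory.LFunctions.weilMellin g (1 / 2 + (γ i : ℂ) * Complex.I))
            (Literature.NumberTheory.LFunctions.weilFunctional g) := by
  rintro B hB ⟨x, C, N, hprof, D, hdes⟩
  have hB0 : 0 ≤ B := (Real.log_nonneg one_le_two).trans hB
  -- (1) a countable dense family of Weil tests of `[-B, B]`
  obtain ⟨g, hg, hdense⟩ :=
    stub_denseFamily_of_isCompact (isCompact_Icc : IsCompact (Set.Icc (-B) B))
  -- (2) designs for its prefixes
  choose δ hδD hδex using fun m => hdes g m hg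
  have hev : ∀ j, ∀ᶠ k in atTop,
      HasSum (fun n => weilMellin (g j) (1 / 2 + ((x n + δ k n : ℝ) : ℂ) * I))
        (weilFunctional (g j)) := fun j =>
    Filter.eventually_atTop.2 ⟨j + 1, fun k hk => hδex k j (by omega)⟩
  -- (3) one limit displacement exact on the whole dense family
  obtain ⟨δ', hδ'D, hδ'ex⟩ := stub_compactness stub_domination x C D N g δ hprof
    (fun j => (hg j).1) hδD hev
  -- (4) extension to every Weil test of `[-B, B]`
  exact ⟨ℕ, fun n => x n + δ' n, fun f hf hfs => stub_designReduction_extension hB0 stub_domination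
    g ⟨hg, hdense⟩ x C D N δ' hprof hδ'D hδ'ex f hf hfs⟩

end Summit.RiemannHypothesis.RiemannHypothesis.Theorems.SpectralTraceWindowStep

end
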